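import Mathlib.Analysis.SpecialFunctions.Pow.Real
import HarnessLib

/-!
# Stub plan `CycleAPIAt3`, P2 `OrbitFloor` — the layer-cake summation (stmt-Schanuel-6117)

Crux `stmt-Schanuel-6117` (`Summit.Schanuel.Schanuel.Theses.DiophantineDichotomy.ApproximationProperty`),
line `orbit-interpolation-determinant`, registered stub `stub_orbitFloor : OrbitFloor` (stub plan P2).
Pure real analysis (all PROVED, no definitions, no named facts): the dyadic LAYER-CAKE summation that
turns a counting bound for the level sets of finitely many reals into a bound for their sum.

* `OrbitFloor.sum_le_levels` — `∑ f ≤ #E · a₁ + ∑_{i<n} 4^{i+1} a₁ · #{4^i a₁ ≤ f}` when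
  `f ≤ 4ⁿ a₁` (induction on `n`, truncating `f` at `4^{n-1} a₁`);
* `OrbitFloor.sum_le_of_count_le` (registered sub-goal `orbitFloor_layerCake`, uncurried at the end
  of the file) — if `f ≤ L` and
  `#{σ : a ≤ f σ} ≤ P + √(B/a)` for every `a ≥ a₁ > 0`, then
  `∑_σ f σ ≤ #E · a₁ + 6 P L + 8 √(B L)` (levels `4^i a₁`, two geometric sums).

Sources: folklore (the stub plan's k2 H3 "pure-ℝ layer cake").
-/

noncomputable section

-- `Summit.Schanuel.Schanuel.…` is the mandated summit/sub-problem namespace (single-conjunct summit), hence: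
set_option linter.dupNamespace false

namespace Summit.Schanuel.Schanuel.Cruxes.ApproximationProperty.OrbitInterpolationDeterminant

open Finset Real
open scoped BigOperators

namespace OrbitFloor

/-- **Levels.** For finitely many reals `f σ ≤ 4ⁿ a₁` (`a₁ > 0`):
`∑ f ≤ #E · a₁ + ∑_{i<n} 4^{i+1} a₁ · #{σ : 4^i a₁ ≤ f σ}`. [folklore] -/
theorem sum_le_levels {E : Type*} [Fintype E] {a₁ : ℝ} (ha₁ : 0 < a₁) :
    ∀ (n : ℕ) (f : E → ℝ), (∀ σ, f σ ≤ 4 ^ n * a₁) →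
      ∑ σ, f σ ≤ Fintype.card E * a₁ +
        ∑ i ∈ Finset.range n, 4 ^ (i + 1) * a₁ *
          ((Finset.univ.filter fun σ => 4 ^ i * a₁ ≤ f σ).card : ℝ) := by
  classical
  intro n
  induction n with
  | zero =>
    intro f hf
    rw [Finset.range_zero, Finset.sum_empty, add_zero]
    calc ∑ σ, f σ ≤ ∑ _σ : E, a₁ := Finset.sum_le_sum fun σ _ => by
            have h := hf σ
            rwa [pow_zero, one_mul] at h
      _ = Fintype.card E * a₁ := by rw [Finset.sum_const, Finset.card_univ, nsmul_eq_mul]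
  | succ n ih =>
    intro f hf
    set c : ℝ := 4 ^ n * a₁ with hc
    have hc0 : 0 < c := by positivity
    set g : E → ℝ := fun σ => min (f σ) c with hg
    have hgle : ∀ σ, g σ ≤ 4 ^ n * a₁ := fun σ => min_le_right _ _
    have ihg := ih g hgle
    -- the levels `i < n` of `g` are those of `f`
    have hlev : ∀ i ∈ Finset.range n,
        (Finset.univ.filter fun σ => 4 ^ i * a₁ ≤ g σ) =
          (Finset.univ.filter fun σ => 4 ^ i * a₁ ≤ f σ) := by
      intro i hi
      have hi' : i < n := Finset.mem_range.mp hi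
      have hle : (4 : ℝ) ^ i * a₁ ≤ c :=
        mul_le_mul_of_nonneg_right (pow_le_pow_right₀ (by norm_num) hi'.le) ha₁.le
      ext σ
      simp only [Finset.mem_filter, Finset.mem_univ, true_and, hg, le_min_iff]
      exact ⟨fun h => h.1, fun h => ⟨h, hle⟩⟩
    have hsum_eq : ∑ i ∈ Finset.range n, 4 ^ (i + 1) * a₁ *
          ((Finset.univ.filter fun σ => 4 ^ i * a₁ ≤ g σ).card : ℝ) =
        ∑ i ∈ Finset.range n, 4 ^ (i + 1) * a₁ *
          ((Finset.univ.filter fun σ => 4 ^ i * a₁ ≤ f σ).card : ℝ) :=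
      Finset.sum_congr rfl fun i hi => by rw [hlev i hi]
    rw [hsum_eq] at ihg
    -- the top level: `f - g ≤ 4c · 1[c ≤ f]`
    have hdiff : ∑ σ, (f σ - g σ) ≤
        4 ^ (n + 1) * a₁ * ((Finset.univ.filter fun σ => 4 ^ n * a₁ ≤ f σ).card : ℝ) := by
      have hpt : ∀ σ, f σ - g σ ≤ 4 ^ (n + 1) * a₁ * (if 4 ^ n * a₁ ≤ f σ then 1 else 0) := by
        intro σ
        by_cases h : 4 ^ n * a₁ ≤ f σ
        · rw [if_pos h, mul_one]
          have h1 : g σ = c := min_eq_right h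
          rw [h1]
          have h2 := hf σ
          linarith
        · rw [if_neg h, mul_zero]
          have h1 : g σ = f σ := min_eq_left (le_of_lt (not_le.mp h))
          rw [h1, sub_self]
      calc ∑ σ, (f σ - g σ)
          ≤ ∑ σ, 4 ^ (n + 1) * a₁ * (if 4 ^ n * a₁ ≤ f σ then (1 : ℝ) else 0) :=
            Finset.sum_le_sum fun σ _ => hpt σ
        _ = 4 ^ (n + 1) * a₁ * ∑ σ, (if 4 ^ n * a₁ ≤ f σ then (1 : ℝ) else 0) := by
            rw [Finset.mul_sum]
        _ = 4 ^ (n + 1) * a₁ * ((Finset.univ.filter fun σ => 4 ^ n * a₁ ≤ f σ).card : ℝ) := by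
            rw [Finset.sum_boole]
    have hsplit : ∑ σ, f σ = ∑ σ, g σ + ∑ σ, (f σ - g σ) := by
      rw [← Finset.sum_add_distrib]
      exact Finset.sum_congr rfl fun σ _ => by ring
    rw [hsplit, Finset.sum_range_succ]
    linarith

/-- **The layer-cake summation** (registered below as `orbitFloor_layerCake`). Let `f` be finitely
many reals with `f σ ≤ L` (`L > 0`), and suppose the level sets are counted by
`#{σ : a ≤ f σ} ≤ P + √(B/a)` for all `a ≥ a₁` (`a₁ > 0`, `P, B ≥ 0`). Then
`∑_σ f σ ≤ #E · a₁ + 6 P L + 8 √(B L)` (levels `4^i a₁` up to the first above `L`; the two geometric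
sums `∑ 4^i ≤ 4ⁿ/3 ≤ 4L/(3a₁)` and `∑ 2^i ≤ 2ⁿ ≤ 2√(L/a₁)`). [folklore] -/
theorem sum_le_of_count_le {E : Type*} [Fintype E] (f : E → ℝ) {L a₁ P B : ℝ}
    (ha₁ : 0 < a₁) (hP : 0 ≤ P) (hB : 0 ≤ B) (hL : 0 < L) (hf : ∀ σ, f σ ≤ L)
    (hN : ∀ a : ℝ, a₁ ≤ a →
      ((Finset.univ.filter fun σ => a ≤ f σ).card : ℝ) ≤ P + Real.sqrt (B / a)) :
    ∑ σ, f σ ≤ Fintype.card E * a₁ + 6 * P * L + 8 * Real.sqrt (B * L) := by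
  classical
  -- the first level above `L`
  have hex : ∃ n : ℕ, L ≤ 4 ^ n * a₁ := by
    obtain ⟨n, hn⟩ := pow_unbounded_of_one_lt (L / a₁) (by norm_num : (1 : ℝ) < 4)
    refine ⟨n, ?_⟩
    rw [div_lt_iff₀ ha₁] at hn
    exact hn.le
  obtain ⟨n, hn, hmin⟩ : ∃ n : ℕ, L ≤ 4 ^ n * a₁ ∧ ∀ m < n, ¬ (L ≤ 4 ^ m * a₁) :=
    ⟨Nat.find hex, Nat.find_spec hex, fun m hm => Nat.find_min hex hm⟩
  have hlev := sum_le_levels ha₁ n f (fun σ => (hf σ).trans hn)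
  -- each level term
  have hterm : ∀ i ∈ Finset.range n,
      4 ^ (i + 1) * a₁ * ((Finset.univ.filter fun σ => 4 ^ i * a₁ ≤ f σ).card : ℝ) ≤
        4 * P * a₁ * 4 ^ i + 4 * Real.sqrt (a₁ * B) * 2 ^ i := by
    intro i _
    have h4i : (1 : ℝ) ≤ 4 ^ i := one_le_pow₀ (by norm_num)
    have hai : a₁ ≤ 4 ^ i * a₁ := le_mul_of_one_le_left ha₁.le h4i
    have hNi := hN _ hai
    have hpos : 0 ≤ (4 : ℝ) ^ (i + 1) * a₁ := by positivity
    have h4ia : 0 < (4 : ℝ) ^ i * a₁ := by positivity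
    -- `4^{i+1} a₁ √(B/(4^i a₁)) = 4 · 2^i √(a₁ B)`
    have hkey : (4 : ℝ) ^ (i + 1) * a₁ * Real.sqrt (B / (4 ^ i * a₁)) =
        4 * Real.sqrt (a₁ * B) * 2 ^ i := by
      have h42 : (4 : ℝ) ^ i = (2 ^ i) ^ 2 := by
        rw [← pow_mul, show (4 : ℝ) = 2 ^ 2 by norm_num, ← pow_mul, mul_comm]
      have hl : (4 : ℝ) ^ (i + 1) * a₁ * Real.sqrt (B / (4 ^ i * a₁)) =
          Real.sqrt ((4 ^ (i + 1) * a₁) * (4 ^ (i + 1) * a₁) * (B / (4 ^ i * a₁))) := by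
        rw [Real.sqrt_mul (mul_self_nonneg _), Real.sqrt_mul_self hpos]
      have hr : 4 * Real.sqrt (a₁ * B) * 2 ^ i =
          Real.sqrt ((4 * 2 ^ i) * (4 * 2 ^ i) * (a₁ * B)) := by
        rw [Real.sqrt_mul (mul_self_nonneg _), Real.sqrt_mul_self (by positivity)]
        ring
      rw [hl, hr]
      congr 1
      rw [pow_succ, h42]
      field_simp
    calc 4 ^ (i + 1) * a₁ * ((Finset.univ.filter fun σ => 4 ^ i * a₁ ≤ f σ).card : ℝ)
        ≤ 4 ^ (i + 1) * a₁ * (P + Real.sqrt (B / (4 ^ i * a₁))) :=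
          mul_le_mul_of_nonneg_left hNi hpos
      _ = 4 * P * a₁ * 4 ^ i + 4 ^ (i + 1) * a₁ * Real.sqrt (B / (4 ^ i * a₁)) := by ring
      _ = 4 * P * a₁ * 4 ^ i + 4 * Real.sqrt (a₁ * B) * 2 ^ i := by rw [hkey]
  have hsum : ∑ i ∈ Finset.range n,
      4 ^ (i + 1) * a₁ * ((Finset.univ.filter fun σ => 4 ^ i * a₁ ≤ f σ).card : ℝ) ≤
        4 * P * a₁ * ((4 ^ n - 1) / 3) + 4 * Real.sqrt (a₁ * B) * (2 ^ n - 1) := by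
    refine (Finset.sum_le_sum hterm).trans (le_of_eq ?_)
    rw [Finset.sum_add_distrib, ← Finset.mul_sum, ← Finset.mul_sum,
      geom_sum_eq (by norm_num : (4 : ℝ) ≠ 1), geom_sum_eq (by norm_num : (2 : ℝ) ≠ 1)]
    norm_num
  -- the two geometric factors against `L`
  have hgeo4 : (4 : ℝ) ^ n * a₁ - a₁ ≤ 4 * L := by
    rcases Nat.eq_zero_or_pos n with h0 | hpos
    · rw [h0, pow_zero, one_mul, sub_self]; linarith
    · obtain ⟨k, rfl⟩ : ∃ k, n = k + 1 := ⟨n - 1, by omega⟩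
      have hk := not_le.mp (hmin k (Nat.lt_succ_self k))
      rw [pow_succ]
      nlinarith
  have hgeo2 : ((2 : ℝ) ^ n - 1) * Real.sqrt a₁ ≤ 2 * Real.sqrt L := by
    rcases Nat.eq_zero_or_pos n with h0 | hpos
    · rw [h0, pow_zero, sub_self, zero_mul]; positivity
    · obtain ⟨k, rfl⟩ : ∃ k, n = k + 1 := ⟨n - 1, by omega⟩
      have hk := not_le.mp (hmin k (Nat.lt_succ_self k))
      have h1 : (2 : ℝ) ^ k * Real.sqrt a₁ ≤ Real.sqrt L := by
        have e : (2 : ℝ) ^ k * Real.sqrt a₁ = Real.sqrt (4 ^ k * a₁) := by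
          rw [Real.sqrt_mul (by positivity), show (4 : ℝ) ^ k = (2 ^ k) ^ 2 by
            rw [← pow_mul, show (4 : ℝ) = 2 ^ 2 by norm_num, ← pow_mul, mul_comm],
            Real.sqrt_sq (by positivity)]
        rw [e]
        exact Real.sqrt_le_sqrt hk.le
      have h2 : ((2 : ℝ) ^ (k + 1) - 1) * Real.sqrt a₁ ≤ 2 ^ (k + 1) * Real.sqrt a₁ :=
        mul_le_mul_of_nonneg_right (by linarith) (Real.sqrt_nonneg _)
      rw [pow_succ] at h2 ⊢
      nlinarith
  -- assemble
  have hA : 4 * P * a₁ * ((4 ^ n - 1) / 3) ≤ 6 * P * L := by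
    have : 4 * P * a₁ * (((4 : ℝ) ^ n - 1) / 3) = (4 * P / 3) * (4 ^ n * a₁ - a₁) := by ring
    rw [this]
    have h43 : 0 ≤ 4 * P / 3 := by positivity
    nlinarith [mul_le_mul_of_nonneg_left hgeo4 h43]
  have hBsq : 4 * Real.sqrt (a₁ * B) * (2 ^ n - 1) ≤ 8 * Real.sqrt (B * L) := by
    have e1 : Real.sqrt (a₁ * B) = Real.sqrt a₁ * Real.sqrt B := Real.sqrt_mul ha₁.le B
    have e2 : Real.sqrt (B * L) = Real.sqrt B * Real.sqrt L := Real.sqrt_mul hB L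
    rw [e1, e2]
    have hB0 : 0 ≤ Real.sqrt B := Real.sqrt_nonneg B
    calc 4 * (Real.sqrt a₁ * Real.sqrt B) * (2 ^ n - 1)
        = 4 * Real.sqrt B * ((2 ^ n - 1) * Real.sqrt a₁) := by ring
      _ ≤ 4 * Real.sqrt B * (2 * Real.sqrt L) :=
          mul_le_mul_of_nonneg_left hgeo2 (by positivity)
      _ = 8 * (Real.sqrt B * Real.sqrt L) := by ring
  linarith

end OrbitFloor

/-- **Registered sub-goal `orbitFloor_layerCake` — the layer-cake summation** (uncurried form of
`OrbitFloor.sum_le_of_count_le`): finitely many reals `f σ ≤ L` whose level sets are counted by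
`#{σ : a ≤ f σ} ≤ P + √(B/a)` for `a ≥ a₁ > 0` have `∑ f ≤ #E · a₁ + 6 P L + 8 √(B L)`. [folklore] -/
theorem orbitFloor_layerCake : ∀ (E : Type) [Fintype E] (f : E → ℝ) (L a₁ P B : ℝ), 0 < a₁ → 0 ≤ P → 0 ≤ B → 0 < L → (∀ σ, f σ ≤ L) → (∀ a : ℝ, a₁ ≤ a → ((Finset.univ.filter fun σ => a ≤ f σ).card : ℝ) ≤ P + Real.sqrt (B / a)) → ∑ σ, f σ ≤ Fintype.card E * a₁ + 6 * P * L + 8 * Real.sqrt (B * L) := by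
  intro E _ f L a₁ P B ha₁ hP hB hL hf hN
  exact OrbitFloor.sum_le_of_count_le f ha₁ hP hB hL hf hN

end Summit.Schanuel.Schanuel.Cruxes.ApproximationProperty.OrbitInterpolationDeterminant

end
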